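import Literature.NumberTheory.EllipticCurves.AnomalousOfRationalTorsionProofs
import Literature.NumberTheory.EllipticCurves.CanonicalPAdicHeightAdmissibleProofs
import Literature.NumberTheory.EllipticCurves.CanonicalPAdicHeightNumeratorProofs
import Literature.NumberTheory.EllipticCurves.CanonicalPAdicHeightThetaProofs
import Literature.NumberTheory.EllipticCurves.PAdicHeightsRegulatorProofs
import Literature.NumberTheory.EllipticCurves.PadicLogNormProofs
import Literature.NumberTheory.EllipticCurves.MordellWeilTheoremProofs
import Literature.NumberTheory.EllipticCurves.TwoIsogenyShaTwoTorsion
import Literature.NumberTheory.EllipticCurves.GeomPointReduction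
import HarnessLib

/-!
# The canonical cyclotomic `p`-adic height takes values in `pℤ_p` off anomalous primes and
# Tamagawa numbers (Mazur–Tate 1983, §3.3 / (4.1.1)); `‖Reg_p‖ ≤ p^{-rank}`

Topic `Literature/NumberTheory/EllipticCurves`; `Proofs`-style companion of `CanonicalPAdicHeight.lean`
(THEOREMS ONLY: no definition, no named fact, no instance). Written by the cell bsd-rank2 literature
seat (GEN 11) for the λ-door of the p2 lane (`Summits/BirchSwinnertonDyer/Rank2/LambdaDoorKernel.lean`),
but the statements are general facts about THE canonical height datum (`PAdicHeightData.IsCanonical`,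
Stein–Wuthrich 2013 (4.1) normalisation `ĥ_p(P) = 2 log_p(e(P)/σ_p(P)) = −2p · h_p^{MST}(P)`).

## The printed statement and its proof

Mazur–Tate 1983, §3.3 (display after (3.3.4)), with §1.2, (4.1.1)–(4.1.2) and (4.4) Prop.: the
canonical `ρ`-pairing of paired abelian varieties `A, B` over a global field takes values in
`Σ_{v∈𝒱_∞} ρ_v(K_v^*) + Σ_{v∈S} (1/m_{A_v})[ρ_v(K_v^*) + (1/(m_{B_v} n_{A_v} n_{B_v})) ρ_v(𝔬_v^*)]
 + Σ_{v∉S,𝒱_∞} (1/m_{A_v}) ρ_v(K_v^*)`, where `m_{A_v}` is the exponent of the component group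
`A₀(k_v)/A₀⁰(k_v)`, `n_{A_v}` that of `A₀⁰(k_v)/T_A(k_v)` (of `Ẽ(k_v)` at a good place), and `S` the
set of places where `ρ_v` ramifies; and Schneider's analytic height is the canonical `ρ_c`-pairing for
`ρ_c = log_p ∘ χ_cyc` ((4.4) Prop.). For `E/ℚ`, `A = B = E`, `ρ = ρ_c` (`S = {p}`, `ρ_v(ℚ_v^*) ⊆
log_p(ℚ_p^×) = pℤ_p` for `p` odd) this reads `ord_p⟨P, Q⟩ ≥ 1 − max(max_ℓ ord_p m_ℓ, 2·ord_p n_p)`: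
the height is `pℤ_p`-valued as soon as `p ∤ #Ẽ(𝔽_p)` (NON-ANOMALOUS, `a_p ≢ 1 mod p`) and `p` is
prime to the component groups (e.g. `p ∤ c_ℓ` for all `ℓ`). The tree's `⟨P, P⟩_{Dh} = ĥ_p^{SW}(P) =
(P, P)_{ρ_c}` (MST06 §1: `h_p = −½(P,P)` for the functional `p⁻¹ log_p ∘ χ`; SW13 footnote 4), so no
normalising factor intervenes.

The proof here is the Mazur–Stein–Tate / Harvey form of the same computation: for an ADMISSIBLE point
`Q` (`Q ∈ E₁(ℚ_p)`, non-singular reduction modulo every prime) `ĥ_p(Q) = 2 log_p(e(Q)/σ_p(Q))` with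
`e/σ_p` a `p`-adic unit (Harvey 2008 §5; tree `PAdicHeightData.IsCanonical.norm_pairing_self_sub_padicLog_num_le`:
`‖ĥ_p(Q) − log_p(num x(Q))‖ ≤ ‖x/y‖ < 1`), hence `ĥ_p(Q) ∈ log_p(ℚ_p^×) + pℤ_p = pℤ_p`; and every
`P ∈ E(ℚ)` has the admissible multiple `mP` with `m = N_p · ∏_{ℓ} [E(ℚ) : E(ℚ) ∩ E⁰(ℚ_ℓ)]`
(MST06 Alg. 3.4 step 1: "`m` could be the least common multiple of the Tamagawa numbers of `E` and
`#E(𝔽_p)`"; AEC VII.2.1), prime to `p` under the two conditions, whence `ĥ_p(P) = ĥ_p(mP)/m² ∈ pℤ_p`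
and, by polarisation (`p` odd), `⟨P, Q⟩ ∈ pℤ_p`. Consequently `Reg_p = det⟨P_i, P_j⟩ ∈ p^{rank} ℤ_p`,
i.e. Kundu–Ray's normalised regulator `𝓡_p = Reg_p/p^{rank}` (= BMS/SW `Reg_γ` up to a unit) is
`p`-integral — the valuation floor observed on 18 756/18 756 members of the cell's `F₂` table at
`p = 5` (`HOME/bsd-rank2-eng/data/f2door/LAMBDA5.md`), with the printed failure modes off the class
(`5 ∣ c_ℓ`: floor `0`; anomalous: floor `−1`).

## What is here

* `norm_padicLog_le_inv` — `‖log_p x‖ ≤ p⁻¹` on `ℚ_p`, `p` odd (`ρ_c(ℚ_v^*) ⊆ pℤ_p`).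
* (private) `norm_det_le_pow_card_of_forall_norm_le` — ultrametric Hadamard: entries of norm `≤ c`
  ⇒ `‖det‖ ≤ c^{card}`.
* `norm_pairing_self_le_of_isAdmissible`, `norm_pairing_le_of_coprime_admissible_multiples`,
  `exists_coprime_admissible_nsmul`, `norm_pairing_le_of_not_anomalous` — the integrality.
* `norm_padicRegulator_le_of_forall_norm_pairing_le` — `‖Reg_p(D)‖ ≤ p^{-rank}`.
* `nonsingularReductionSubgroupAt_eq_top_of_norm_Δ_eq_one`, `index_…_eq_one_of_norm_Δ_eq_one`,
  `index_…_eq_one_of_hasGoodReductionAtPrime`, `not_dvd_index_…_of_bad` — at a good prime the index is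
  `1` (Mazur–Tate's `m_{A_v} = 1`), so the index hypothesis concerns only the bad primes.
* `norm_Δ_le_of_not_hasNonsingularReductionAt` (a rational point with singular reduction forces
  `‖Δ‖_ℓ ≤ ℓ⁻²`), `nonsingularReductionSubgroupAt_eq_top_of_lt_norm_Δ`,
  `index_nonsingularReductionSubgroupAt_eq_one_of_not_sq_dvd` — at a prime with `ℓ² ∤ Δ_min` (types
  I₀, I₁: `c_ℓ = 1`) the index is `1`: square-free discriminant sieves discharge the index hypothesis.

## References

* B. Mazur, J. Tate, *Canonical height pairings via biextensions*, in Arithmetic and Geometry I,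
  Progr. Math. 35 (1983) 195–237: §1.2, §3.3 (display after (3.3.4)), (4.1.1)–(4.1.2), (4.4) Prop.
  (held: book:artin1983-arithmetic-geometry). [MazurTate1983Biext]
* B. Mazur, W. Stein, J. Tate, Doc. Math. Extra Vol. Coates (2006), §1 eq. (1.1), Alg. 3.4 (steps 1,
  4), §4 tables ("the regulator for p = 5 is not a unit, and #E(𝔽₅) = 9"). [MazurSteinTate2006]
* D. Harvey, LMS J. Comput. Math. 11 (2008), §5. [Harvey2008]
* W. Stein, C. Wuthrich, Math. Comp. 82 (2013), §4 (4.1) and footnote 4, §4.4. [SteinWuthrich2013]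
* D. Kundu, A. Ray, IJNT 20 (2024) = arXiv:2106.12095, §3 (normalised regulator `𝓡_p`). [KunduRay2024]
* J. Coates, *Infinite descent on elliptic curves with complex multiplication*, ibid. 107–137, Thm 17
  (the CM prototype `m_𝔭⁻¹⟨x,y⟩_𝔭 ∈ 𝔬_𝔭`). [Coates1983InfiniteDescent]
* J. H. Silverman, AEC 2nd ed., VII.2.1, VII.3.1, VII.6.1. [SilvermanAEC2009]
-/

noncomputable section

open scoped Classical

namespace Literature.NumberTheory.EllipticCurves

/-! ### §0. `‖log_p x‖ ≤ p⁻¹` and an ultrametric determinant bound -/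

section Padic

variable {p : ℕ} [Fact p.Prime]

/-- **The Iwasawa logarithm maps `ℚ_p` into `pℤ_p` for odd `p`**: `‖log_p x‖ ≤ p⁻¹`
(`log_p 0 = log_p p = 0`; for the unit part `u`, `‖log_p x‖ = ‖u^{p−1} − 1‖ < 1`, tree theorem
`norm_padicLog_eq_norm_unitPart_pow_sub_one`). This is `ρ_c(ℚ_v^*) ⊆ pℤ_p` of Mazur–Tate §3.3 for the
cyclotomic `ρ_c = log_p ∘ χ`. (The same statement is proved cell-side as
`Summit.BirchSwinnertonDyer.Rank1Residual.X2.norm_padicLog_le`, which a Literature file cannot import;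
restated here at Literature level.) [cite: Iwasawa1972PadicL, §4.4] -/
theorem norm_padicLog_le_inv (hp2 : p ≠ 2) (x : ℚ_[p]) : ‖padicLog p x‖ ≤ (p : ℝ)⁻¹ := by
  have hpp : p.Prime := Fact.out
  by_cases hx : x = 0
  · rw [hx, padicLog_zero, norm_zero]; positivity
  rw [norm_padicLog_eq_norm_unitPart_pow_sub_one hp2 hx]
  refine norm_le_inv_of_norm_lt_one (norm_pow_sub_one_lt_one_of_norm_eq_one ?_)
  have hp0 : (p : ℝ) ≠ 0 := by exact_mod_cast hpp.ne_zero
  rw [norm_mul, norm_zpow, Padic.norm_p, Padic.norm_eq_zpow_neg_valuation hx, inv_zpow', neg_neg,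
    ← zpow_add₀ hp0, neg_add_cancel, zpow_zero]

/-- **Ultrametric Hadamard bound**: a square matrix over `ℚ_p` with all entries of norm `≤ c` has
determinant of norm `≤ c^n` (Leibniz expansion: each term is `±` a product of `n` entries, and the
norm of a sum is at most the largest norm of a summand). [folklore] -/
private theorem norm_det_le_pow_card_of_forall_norm_le {ι : Type*} [Fintype ι] {c : ℝ} (hc : 0 ≤ c)
    (M : Matrix ι ι ℚ_[p]) (hM : ∀ i j, ‖M i j‖ ≤ c) : ‖M.det‖ ≤ c ^ Fintype.card ι := by
  rw [Matrix.det_apply]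
  refine IsUltrametricDist.norm_sum_le_of_forall_le_of_nonneg (pow_nonneg hc _) fun σ _ ↦ ?_
  have hsign : ‖Equiv.Perm.sign σ • ∏ i, M (σ i) i‖ = ‖∏ i, M (σ i) i‖ := by
    rcases Int.units_eq_one_or (Equiv.Perm.sign σ) with h | h
    · rw [h, one_smul]
    · rw [h, Units.neg_smul, one_smul, norm_neg]
  rw [hsign, norm_prod]
  calc ∏ i, ‖M (σ i) i‖ ≤ ∏ _i : ι, c :=
        Finset.prod_le_prod (fun i _ ↦ norm_nonneg _) (fun i _ ↦ hM _ _)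
    _ = c ^ Fintype.card ι := by rw [Finset.prod_const, Finset.card_univ]

end Padic

end Literature.NumberTheory.EllipticCurves

namespace WeierstrassCurve

open Literature.NumberTheory.EllipticCurves

/-! ### §1. Integrality of the canonical cyclotomic `p`-adic height (Mazur–Tate 1983 §3.3) -/

section Integrality

variable (W : WeierstrassCurve ℚ) [W.IsElliptic] [W.IsGloballyMinimal] (p : ℕ) [Fact p.Prime]

omit [W.IsElliptic] in
/-- **`ĥ_p(Q) ∈ pℤ_p` for an admissible point** (`Q ∈ E₁(ℚ_p)`, non-singular reduction everywhere,
`p` odd; THE canonical datum): `ĥ_p(Q) = 2 log_p(e(Q)/σ_p(Q))` with `e/σ_p` a `p`-adic unit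
(Harvey 2008 §5; tree: `‖ĥ_p(Q) − log_p(num x)‖ ≤ ‖x/y‖ < 1`) and `log_p(ℚ_p^×) ⊆ pℤ_p`. The term
`ρ_p(𝔬_p^*)` of Mazur–Tate's value subgroup.
[cite: MazurTate1983Biext, §3.3 (display after (3.3.4)) and (4.4) Prop.]
[cite: Harvey2008, §5] [cite: MazurSteinTate2006, §1 eq. (1.1)] -/
theorem norm_pairing_self_le_of_isAdmissible (hp2 : p ≠ 2) {D : PAdicHeightData W p}
    (hD : D.IsCanonical) {P : W.toAffine.Point} (hP : W.IsAdmissible p P) :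
    ‖D.pairing P P‖ ≤ (p : ℝ)⁻¹ := by
  rcases P with _ | ⟨x, y, h⟩
  · exact (hP.2 : False).elim
  · have hx : 1 < ‖(x : ℚ_[p])‖ := hP.2.1
    have hsub := PAdicHeightData.IsCanonical.norm_pairing_self_sub_padicLog_num_le W p hD hp2 hP
    have hz : ‖(x : ℚ_[p]) / y‖ ≤ (p : ℝ)⁻¹ := by
      refine norm_le_inv_of_norm_lt_one ?_
      have h2 := norm_div_sq_eq_inv_norm_of_one_lt_norm (p := p) h hx
      have hlt : ‖(x : ℚ_[p]) / y‖ ^ 2 < 1 := by rw [h2]; exact inv_lt_one_of_one_lt₀ hx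
      exact (pow_lt_one_iff_of_nonneg (norm_nonneg _) two_ne_zero).mp hlt
    calc ‖D.pairing (.some x y h) (.some x y h)‖
        = ‖(D.pairing (.some x y h) (.some x y h) - padicLog p (x.num : ℚ_[p])) +
            padicLog p (x.num : ℚ_[p])‖ := by rw [sub_add_cancel]
      _ ≤ max ‖D.pairing (.some x y h) (.some x y h) - padicLog p (x.num : ℚ_[p])‖
            ‖padicLog p (x.num : ℚ_[p])‖ := IsUltrametricDist.norm_add_le_max _ _
      _ ≤ (p : ℝ)⁻¹ := max_le (hsub.trans hz) (norm_padicLog_le_inv hp2 _)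

omit [W.IsElliptic] in
/-- **Integrality from prime-to-`p` admissible multiples** (Mazur–Tate 1983 §3.3 / (4.1.1) in the
Mazur–Stein–Tate form `h_p(P) = h_p(mP)/m²`, Alg. 3.4): if every non-torsion `P ∈ E(ℚ)` has an
admissible multiple `mP` with `p ∤ m`, then THE canonical cyclotomic `p`-adic height pairing (`p` odd)
takes values in `pℤ_p`: `‖⟨P, Q⟩‖ ≤ p⁻¹` for all `P, Q ∈ E(ℚ)` (diagonal by `⟨mP,mP⟩ = m²⟨P,P⟩`,
`‖m‖ = 1`; off-diagonal by polarisation, `‖2‖ = 1`; torsion pairs to `0`).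
[cite: MazurTate1983Biext, (4.1.1)–(4.1.2)] [cite: MazurSteinTate2006, §1 and Alg. 3.4 (steps 1, 4)] -/
theorem norm_pairing_le_of_coprime_admissible_multiples (hp2 : p ≠ 2) {D : PAdicHeightData W p}
    (hD : D.IsCanonical)
    (hadm : ∀ P : W.toAffine.Point, ¬ IsOfFinAddOrder P → ∃ m : ℕ, ¬ p ∣ m ∧ W.IsAdmissible p (m • P))
    (P Q : W.toAffine.Point) : ‖D.pairing P Q‖ ≤ (p : ℝ)⁻¹ := by
  have hpp : p.Prime := Fact.out
  -- the diagonal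
  have hdiag : ∀ R : W.toAffine.Point, ‖D.pairing R R‖ ≤ (p : ℝ)⁻¹ := by
    intro R
    by_cases hR : IsOfFinAddOrder R
    · rw [D.map_torsion R R hR, norm_zero]; positivity
    obtain ⟨m, hpm, hmR⟩ := hadm R hR
    have hmm : D.pairing (m • R) (m • R) = ((m : ℚ_[p]) * m) * D.pairing R R := by
      rw [map_nsmul (D.pairing (m • R)) m R, D.symm (m • R) R, map_nsmul (D.pairing R) m R, smul_smul,
        nsmul_eq_mul, Nat.cast_mul]
    have hm1 : ‖(m : ℚ_[p])‖ = 1 :=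
      Padic.norm_natCast_eq_one_iff.mpr ((Nat.Prime.coprime_iff_not_dvd hpp).mpr hpm)
    have key := norm_pairing_self_le_of_isAdmissible W p hp2 hD hmR
    rwa [hmm, norm_mul, norm_mul, hm1, one_mul, one_mul] at key
  -- polarisation
  have hpol : (2 : ℚ_[p]) * D.pairing P Q =
      D.pairing (P + Q) (P + Q) - D.pairing P P - D.pairing Q Q := by
    simp only [map_add, AddMonoidHom.add_apply, D.symm Q P]; ring
  have hsub : ∀ a b : ℚ_[p], ‖a - b‖ ≤ max ‖a‖ ‖b‖ := fun a b ↦ by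
    rw [sub_eq_add_neg, ← norm_neg b]; exact IsUltrametricDist.norm_add_le_max a (-b)
  have h2 : ‖(2 : ℚ_[p])‖ = 1 := by
    have : ((2 : ℕ) : ℚ_[p]) = 2 := by norm_num
    rw [← this, Padic.norm_natCast_eq_one_iff]
    exact (Nat.coprime_primes hpp Nat.prime_two).mpr hp2
  have key : ‖(2 : ℚ_[p]) * D.pairing P Q‖ ≤ (p : ℝ)⁻¹ := by
    rw [hpol]
    refine (hsub _ _).trans (max_le ?_ (hdiag Q))
    exact (hsub _ _).trans (max_le (hdiag _) (hdiag P))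
  rwa [norm_mul, h2, one_mul] at key

omit [W.IsElliptic] in
/-- **Prime-to-`p` admissible multiples exist on the class `𝒞_p`.** For `W/ℚ` globally minimal
elliptic, a good prime `p ≥ 3` with `a_p ≢ 1 (mod p)` (NON-ANOMALOUS: `p ∤ N_p = #Ẽ(𝔽_p)`) such that
`p ∤ [E(ℚ) : E(ℚ) ∩ E⁰(ℚ_ℓ)]` for every prime `ℓ` (implied by `p ∤ c_ℓ`; the index is `1` at good `ℓ`),
every non-torsion `P ∈ E(ℚ)` has an ADMISSIBLE multiple `mP` with `p ∤ m`:
`m = N_p · ∏_{ℓ bad for P} [E(ℚ) : E(ℚ) ∩ E⁰(ℚ_ℓ)]` — `N_p · E(ℚ) ⊆ E₁(ℚ_p)` (AEC VII.2.1, tree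
`isInReductionKernel_reductionPointCount_nsmul`), `[E(ℚ) : H] • P ∈ H`, and for odd `p` a point of
`E₁(ℚ_p)` is in the sigma disc. These are Mazur–Tate's exponents `n_{A_p}` and `m_{A_ℓ}` being prime
to `p`. [cite: MazurTate1983Biext, §1.2 and (4.1.2)] [cite: MazurSteinTate2006, Alg. 3.4 step 1]
[cite: SilvermanAEC2009, VII.2.1 and VII.6.1] -/
theorem exists_coprime_admissible_nsmul (hp : 3 ≤ p) (hgood : W.HasGoodReductionAtPrime p)
    (hna : ¬ (p : ℤ) ∣ W.frobeniusTrace p - 1)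
    (hidx : ∀ (ℓ : ℕ) [Fact ℓ.Prime], ¬ p ∣ (W.nonsingularReductionSubgroupAt ℓ).index)
    (P : W.toAffine.Point) (hP : ¬ IsOfFinAddOrder P) :
    ∃ m : ℕ, ¬ p ∣ m ∧ W.IsAdmissible p (m • P) := by
  have hpp : p.Prime := Fact.out
  have hp2 : p ≠ 2 := by omega
  have hΔ : ¬ (p : ℤ) ∣ minimalDiscriminantInt W :=
    not_dvd_minimalDiscriminantInt_of_hasGoodReductionAtPrime' W p hgood
  have hNp : ¬ p ∣ W.reductionPointCount p := fun h ↦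
    hna ((dvd_reductionPointCount_iff_dvd_frobeniusTrace_sub_one W p).mp h)
  obtain ⟨x, y, h, rfl⟩ := exists_eq_some_of_not_isOfFinAddOrder hP
  -- the finitely many primes at which `P` may have singular reduction
  obtain ⟨S, hS⟩ := exists_finset_forall_hasNonsingularReductionAt h
  set e0 : ℕ → ℕ := fun ℓ =>
    if hℓ : ℓ.Prime then (haveI := Fact.mk hℓ; (W.nonsingularReductionSubgroupAt ℓ).index) else 1
    with he0def
  have he0 : ∀ ℓ, ¬ p ∣ e0 ℓ := fun ℓ => by
    simp only [he0def]
    split_ifs with hℓ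
    · haveI := Fact.mk hℓ; exact hidx ℓ
    · exact hpp.not_dvd_one
  set m₀ := ∏ ℓ ∈ S, e0 ℓ with hm₀
  have hm₀p : ¬ p ∣ m₀ := by
    rw [hm₀]
    intro hdvd
    obtain ⟨ℓ, -, hℓ⟩ := (Prime.dvd_finsetProd_iff hpp.prime _).mp hdvd
    exact he0 ℓ hℓ
  have hm₀P : ∀ ℓ : ℕ, (hℓ : ℓ.Prime) → haveI := Fact.mk hℓ;
      m₀ • (Affine.Point.some x y h) ∈ W.nonsingularReductionSubgroupAt ℓ := by
    intro ℓ hℓ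
    haveI := Fact.mk hℓ
    by_cases hℓS : ℓ ∈ S
    · obtain ⟨k, hk⟩ : e0 ℓ ∣ m₀ := Finset.dvd_prod_of_mem e0 hℓS
      rw [hk, mul_nsmul (Affine.Point.some x y h)]
      refine AddSubgroup.nsmul_mem _ ?_ k
      have : e0 ℓ = (W.nonsingularReductionSubgroupAt ℓ).index := by simp only [he0def, dif_pos hℓ]
      rw [this]
      exact AddSubgroup.nsmul_index_mem _ _
    · exact AddSubgroup.nsmul_mem _ ((mem_nonsingularReductionSubgroupAt_iff _).mpr
        ((W.reducesNonsingularlyAt_some ℓ h).mpr (hS ℓ hℓ hℓS))) m₀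
  -- `Q = (m₀ N_p) P` lies in `E₁` at `p` and in `E₀` at every prime, and is non-torsion
  have hQfin : ¬ IsOfFinAddOrder ((m₀ * W.reductionPointCount p) • (Affine.Point.some x y h)) :=
    fun hf => hP (hf.of_nsmul (Nat.mul_ne_zero (fun h0 ↦ hm₀p (h0 ▸ dvd_zero p))
      (fun h0 ↦ hNp (h0 ▸ dvd_zero p))))
  have hQ₀ : ∀ ℓ : ℕ, (hℓ : ℓ.Prime) → haveI := Fact.mk hℓ;
      (m₀ * W.reductionPointCount p) • (Affine.Point.some x y h) ∈
        W.nonsingularReductionSubgroupAt ℓ := by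
    intro ℓ hℓ
    haveI := Fact.mk hℓ
    rw [mul_nsmul (Affine.Point.some x y h)]
    exact AddSubgroup.nsmul_mem _ (hm₀P ℓ hℓ) _
  have hker := W.isInReductionKernel_reductionPointCount_nsmul p hΔ
    (W.toPadicPoint p (m₀ • Affine.Point.some x y h))
  rw [← map_nsmul, ← mul_nsmul] at hker
  obtain ⟨xq, yq, hq, hQeq⟩ := exists_eq_some_of_not_isOfFinAddOrder hQfin
  rw [hQeq] at hQ₀ hQfin hker
  rw [toPadicPoint_some, isInReductionKernel_some] at hker
  refine ⟨m₀ * W.reductionPointCount p,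
    fun hdvd ↦ ((Nat.Prime.dvd_mul hpp).mp hdvd).elim hm₀p hNp, ?_⟩
  rw [hQeq]
  refine ⟨hQfin, hker, (W.inSigmaDisc_of_one_lt_norm hp2 hq hker).2, fun ℓ hℓ => ?_⟩
  haveI := Fact.mk hℓ
  exact (W.reducesNonsingularlyAt_some ℓ _).mp ((mem_nonsingularReductionSubgroupAt_iff _).mp (hQ₀ ℓ hℓ))

omit [W.IsElliptic] in
/-- **Integrality on `𝒞_p`, packaged** (Mazur–Tate 1983 §3.3 specialised to `E/ℚ`, `ρ_c`): at a good
prime `p ≥ 3` with `a_p ≢ 1 (mod p)` and `p ∤ [E(ℚ) : E(ℚ) ∩ E⁰(ℚ_ℓ)]` for all `ℓ`, THE canonical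
cyclotomic `p`-adic height pairing takes values in `pℤ_p`.
[cite: MazurTate1983Biext, §3.3 (display after (3.3.4)), (4.1.1)–(4.1.2), (4.4) Prop.] -/
theorem norm_pairing_le_of_not_anomalous (hp : 3 ≤ p) (hgood : W.HasGoodReductionAtPrime p)
    (hna : ¬ (p : ℤ) ∣ W.frobeniusTrace p - 1)
    (hidx : ∀ (ℓ : ℕ) [Fact ℓ.Prime], ¬ p ∣ (W.nonsingularReductionSubgroupAt ℓ).index)
    {D : PAdicHeightData W p} (hD : D.IsCanonical) (P Q : W.toAffine.Point) :
    ‖D.pairing P Q‖ ≤ (p : ℝ)⁻¹ :=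
  norm_pairing_le_of_coprime_admissible_multiples W p (by omega) hD
    (exists_coprime_admissible_nsmul W p hp hgood hna hidx) P Q

omit [W.IsGloballyMinimal] in
/-- **`‖Reg_p(D)‖ ≤ p^{-rank}`** from `‖⟨P,Q⟩_D‖ ≤ p⁻¹`: the regulator is the Gram determinant of a
Mordell–Weil basis (`padicRegulatorOf_eq_padicRegulator_holds`, `exists_isMordellWeilBasis_holds`),
whose `rank` × `rank` entries lie in `pℤ_p`. Equivalently: Kundu–Ray's normalised regulator
`𝓡_p = Reg_p / p^{rank}` is `p`-integral on `𝒞_p`. [cite: KunduRay2024, §3 (display before Thm 3.6)]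
[cite: MazurTate1983Biext, (4.1.1)] -/
theorem norm_padicRegulator_le_of_forall_norm_pairing_le {D : PAdicHeightData W p}
    (h : ∀ P Q : W.toAffine.Point, ‖D.pairing P Q‖ ≤ (p : ℝ)⁻¹) :
    ‖padicRegulator D‖ ≤ (p : ℝ)⁻¹ ^ W.mordellWeilRank := by
  obtain ⟨P, hP⟩ := W.exists_isMordellWeilBasis_holds
  rw [← hP.padicRegulatorOf_eq_padicRegulator D]
  have hdet := norm_det_le_pow_card_of_forall_norm_le (by positivity : (0 : ℝ) ≤ (p : ℝ)⁻¹)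
    (D.pairingMatrix P) (fun i j ↦ show ‖D.pairing (P i) (P j)‖ ≤ _ from h _ _)
  rwa [Fintype.card_fin] at hdet

end Integrality



/-! ### §2. At a prime of good reduction the local index is `1` (Mazur–Tate's `m_{A_v} = 1` at good `v`),
so the index hypothesis of `exists_coprime_admissible_nsmul` concerns only the primes dividing `Δ_W` -/

section GoodPrimes

variable (W : WeierstrassCurve ℚ) [W.IsIntegral ℤ] (ℓ : ℕ) [Fact ℓ.Prime]

/-- **At a prime `ℓ` with `‖Δ_W‖_ℓ = 1` every rational point reduces non-singularly** (for a
`ℤ`-integral equation): `E(ℚ) ∩ E⁰(ℚ_ℓ) = E(ℚ)`, i.e. `W.nonsingularReductionSubgroupAt ℓ = ⊤` — the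
reduced curve is smooth (tree theorem `hasNonsingularReduction_of_isUnit_Δ` for the local model over
`ℤ_(ℓ)`, whose discriminant is a unit iff `‖Δ_W‖_ℓ = 1`). [cite: SilvermanAEC2009, VII.2.1 and VII.5.1]
[cite: MazurTate1983Biext, §1.2] -/
theorem nonsingularReductionSubgroupAt_eq_top_of_norm_Δ_eq_one (hΔ : ‖(W.Δ : ℚ_[ℓ])‖ = 1) :
    W.nonsingularReductionSubgroupAt ℓ = ⊤ := by
  have hv := integers_localIntegers ℓ
  have hmap : W.Δ = algebraMap (localIntegers ℓ) ℚ (W.localModel ℓ).Δ := by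
    have h := (W.localModel ℓ).map_Δ (algebraMap (localIntegers ℓ) ℚ)
    rwa [show (W.localModel ℓ).map (algebraMap (localIntegers ℓ) ℚ) = W from rfl] at h
  have hunit : IsUnit (W.localModel ℓ).Δ := by
    refine hv.isUnit_of_one' ?_
    rw [← hmap, ratAdicValuation_apply, ← NNReal.coe_inj, coe_nnnorm, NNReal.coe_one]
    exact hΔ
  rw [eq_top_iff]
  intro P _
  exact hasNonsingularReduction_of_isUnit_Δ hv hunit P

/-- **… hence `[E(ℚ) : E(ℚ) ∩ E⁰(ℚ_ℓ)] = 1` at such `ℓ`.** [cite: SilvermanAEC2009, VII.2.1 and VII.5.1] -/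
theorem index_nonsingularReductionSubgroupAt_eq_one_of_norm_Δ_eq_one (hΔ : ‖(W.Δ : ℚ_[ℓ])‖ = 1) :
    (W.nonsingularReductionSubgroupAt ℓ).index = 1 := by
  rw [W.nonsingularReductionSubgroupAt_eq_top_of_norm_Δ_eq_one ℓ hΔ, AddSubgroup.index_top]

end GoodPrimes

section GoodPrimesMinimal

variable (W : WeierstrassCurve ℚ) [W.IsGloballyMinimal] (ℓ : ℕ) [Fact ℓ.Prime]

/-- **For a globally minimal equation and a prime `ℓ` of good reduction, `[E(ℚ) : E(ℚ) ∩ E⁰(ℚ_ℓ)] = 1`**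
(`ℓ ∤ Δ_min`, tree `not_dvd_minimalDiscriminantInt_of_hasGoodReductionAtPrime'`). Consequently the
hypothesis `∀ ℓ, p ∤ [E(ℚ) : E(ℚ) ∩ E⁰(ℚ_ℓ)]` of `exists_coprime_admissible_nsmul` /
`norm_pairing_le_of_not_anomalous` only needs checking at the bad primes.
[cite: SilvermanAEC2009, VII.2.1 and VII.5.1] [cite: MazurTate1983Biext, §1.2] -/
theorem index_nonsingularReductionSubgroupAt_eq_one_of_hasGoodReductionAtPrime
    (hgood : W.HasGoodReductionAtPrime ℓ) : (W.nonsingularReductionSubgroupAt ℓ).index = 1 := by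
  refine W.index_nonsingularReductionSubgroupAt_eq_one_of_norm_Δ_eq_one ℓ ?_
  have hdvd : ¬ (ℓ : ℤ) ∣ minimalDiscriminantInt W :=
    not_dvd_minimalDiscriminantInt_of_hasGoodReductionAtPrime' W ℓ hgood
  have hcast : (W.Δ : ℚ_[ℓ]) = ((minimalDiscriminantInt W : ℤ) : ℚ_[ℓ]) := by
    rw [← cast_minimalDiscriminantInt W, Rat.cast_intCast]
  rw [hcast]
  refine le_antisymm (Padic.norm_int_le_one _) (not_lt.mp fun hlt ↦ hdvd ?_)
  exact Padic.norm_intCast_lt_one_iff.mp hlt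

/-- **The index hypothesis reduced to the bad primes**: for `W` globally minimal, if `p` does not divide
`[E(ℚ) : E(ℚ) ∩ E⁰(ℚ_ℓ)]` at every prime `ℓ` of BAD reduction, then at every prime.
[cite: SilvermanAEC2009, VII.2.1 and VII.5.1] -/
theorem not_dvd_index_nonsingularReductionSubgroupAt_of_bad {p : ℕ} (hp : p ≠ 1)
    (hbad : ∀ (ℓ : ℕ) [Fact ℓ.Prime], ¬ W.HasGoodReductionAtPrime ℓ →
      ¬ p ∣ (W.nonsingularReductionSubgroupAt ℓ).index)
    (ℓ : ℕ) [Fact ℓ.Prime] : ¬ p ∣ (W.nonsingularReductionSubgroupAt ℓ).index := by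
  by_cases hgood : W.HasGoodReductionAtPrime ℓ
  · rw [W.index_nonsingularReductionSubgroupAt_eq_one_of_hasGoodReductionAtPrime ℓ hgood]
    exact fun h ↦ hp (Nat.dvd_one.mp h)
  · exact hbad ℓ hgood

end GoodPrimesMinimal


/-! ### §3. A rational point with SINGULAR reduction at `ℓ` forces `ℓ² ∣ Δ_W`; hence at a prime with
`v_ℓ(Δ_W) ≤ 1` (reduction type I₀ or I₁, where `c_ℓ = 1`) every rational point reduces non-singularly -/

section SingularPoint

/-- **Translation invariance of `Δ` combined with "`a₆ = 0 ⇒ Δ ∈ (a₃, a₄)²`"**, as one polynomial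
identity: for a point `(x, y)` on `V`, translating it to the origin gives coefficients
`A₃ = 2y + a₁x + a₃ = Φ_y`, `A₄ = 3x² + 2a₂x + a₄ − a₁y = −Φ_x`, `A₂ = a₂ + 3x`, `a₆' = 0`, the same
`Δ`, and `Δ = A₃²·𝒜 + A₃A₄·ℬ + A₄²·𝒞` with `𝒜, ℬ, 𝒞` integral polynomials (read off
`Δ = −b₂²b₈ − 8b₄³ − 27b₆² + 9b₂b₄b₆` with `b₆ = A₃²`, `b₈ = −a₁A₃A₄ + A₂A₃² − A₄²`, `b₄ = 2A₄ + a₁A₃`).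
[Silverman AEC III.1 (b- and Δ-formulas, translation `u = 1`)] [folklore] -/
private theorem Δ_eq_of_point {R : Type*} [CommRing R] (V : WeierstrassCurve R) (x y : R)
    (heq : y ^ 2 + V.a₁ * x * y + V.a₃ * y - (x ^ 3 + V.a₂ * x ^ 2 + V.a₄ * x + V.a₆) = 0)
    {A₂ A₃ A₄ B₂ : R} (hA₂ : A₂ = V.a₂ + 3 * x) (hA₃ : A₃ = 2 * y + V.a₁ * x + V.a₃)
    (hA₄ : A₄ = 3 * x ^ 2 + 2 * V.a₂ * x + V.a₄ - V.a₁ * y) (hB₂ : B₂ = V.a₁ ^ 2 + 4 * A₂) :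
    V.Δ = A₃ ^ 2 * (-A₂ * B₂ ^ 2 - 48 * V.a₁ ^ 2 * A₄ - 8 * V.a₁ ^ 3 * A₃ - 27 * A₃ ^ 2
          + 18 * B₂ * A₄ + 9 * V.a₁ * B₂ * A₃)
      + A₃ * A₄ * (V.a₁ * B₂ ^ 2) + A₄ ^ 2 * (B₂ ^ 2 - 64 * A₄ - 96 * V.a₁ * A₃) := by
  subst hA₂ hA₃ hA₄ hB₂
  simp only [WeierstrassCurve.Δ, WeierstrassCurve.b₂, WeierstrassCurve.b₄, WeierstrassCurve.b₆,
    WeierstrassCurve.b₈]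
  linear_combination ((V.a₁ ^ 2 + 4 * (V.a₂ + 3 * x)) ^ 3 + 216 * (2 * y + V.a₁ * x + V.a₃) ^ 2
      - 36 * (V.a₁ ^ 2 + 4 * (V.a₂ + 3 * x)) *
        (2 * (3 * x ^ 2 + 2 * V.a₂ * x + V.a₄ - V.a₁ * y) + V.a₁ * (2 * y + V.a₁ * x + V.a₃))
      - 432 * (y ^ 2 + V.a₁ * x * y + V.a₃ * y - (x ^ 3 + V.a₂ * x ^ 2 + V.a₄ * x + V.a₆))) * heq

variable (W : WeierstrassCurve ℚ) [W.IsIntegral ℤ] (ℓ : ℕ) [Fact ℓ.Prime]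

/-- **A rational point with singular reduction modulo `ℓ` forces `‖Δ_W‖_ℓ ≤ ℓ⁻²`** (`ℤ`-integral
equation). If `P = (x, y) ∈ E(ℚ)` is `ℓ`-integral and both partial derivatives `Φ_x(P), Φ_y(P)` are
non-units at `ℓ` (i.e. `P̄` is a singular point of `W̄`), translate `P` to the origin: the new
equation has `a₆' = 0`, `a₃' = Φ_y(P)`, `a₄' = −Φ_x(P)` in `ℓℤ_ℓ` and the same discriminant, and
`Δ ∈ (a₃', a₄')² ⊆ ℓ²ℤ_ℓ` (`Δ_eq_of_point`). Equivalently: if `v_ℓ(Δ_W) ≤ 1` — reduction type I₀ or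
I₁, where the component group is trivial and `c_ℓ = 1` — then `E(ℚ) ∩ E⁰(ℚ_ℓ) = E(ℚ)`.
[Silverman AEC VII.2.1, VII.6.1; Tate's algorithm (ATAEC IV.9), type I₁: `c = 1`]
[cite: SilvermanAEC2009, VII.2.1 and VII.6.1] -/
theorem norm_Δ_le_of_not_hasNonsingularReductionAt {x y : ℚ} (h : W.toAffine.Nonsingular x y)
    (hns : ¬ W.HasNonsingularReductionAt ℓ x y) : ‖(W.Δ : ℚ_[ℓ])‖ ≤ (ℓ : ℝ)⁻¹ ^ 2 := by
  have hv := integers_localIntegers ℓ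
  simp only [HasNonsingularReductionAt, not_or, not_and] at hns
  obtain ⟨hx, hΦx, hΦy⟩ := hns
  -- `x`, `y` and the coefficients are `ℓ`-integral
  have hX : ‖(x : ℚ_[ℓ])‖ ≤ 1 := not_lt.mp fun hlt ↦ hx ((one_lt_norm_ratCast_iff ℓ x).mp hlt)
  have hY : ‖(y : ℚ_[ℓ])‖ ≤ 1 := by
    have hx' : ratAdicValuation ℓ x ≤ 1 := by
      rw [ratAdicValuation_apply, ← NNReal.coe_le_coe, coe_nnnorm, NNReal.coe_one]; exact hX
    have h1 : ((W.localModel ℓ).baseChange ℚ).toAffine.Equation x y := by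
      rw [baseChange_localModel]; exact h.1
    have hy' := v_Y_le_one_of_v_X_le_one hv h1 hx'
    rw [ratAdicValuation_apply, ← NNReal.coe_le_coe, coe_nnnorm, NNReal.coe_one] at hy'; exact hy'
  have ha₁ : ‖(W.a₁ : ℚ_[ℓ])‖ ≤ 1 := (mem_localIntegers_iff ℓ _).mp (W.a₁_mem_localIntegers ℓ)
  have ha₂ : ‖(W.a₂ : ℚ_[ℓ])‖ ≤ 1 := (mem_localIntegers_iff ℓ _).mp (W.a₂_mem_localIntegers ℓ)
  have ha₃ : ‖(W.a₃ : ℚ_[ℓ])‖ ≤ 1 := (mem_localIntegers_iff ℓ _).mp (W.a₃_mem_localIntegers ℓ)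
  have ha₄ : ‖(W.a₄ : ℚ_[ℓ])‖ ≤ 1 := (mem_localIntegers_iff ℓ _).mp (W.a₄_mem_localIntegers ℓ)
  have ha₆ : ‖(W.a₆ : ℚ_[ℓ])‖ ≤ 1 := (mem_localIntegers_iff ℓ _).mp (W.a₆_mem_localIntegers ℓ)
  -- lift everything to `ℤ_ℓ`
  obtain ⟨X, hXc⟩ : ∃ X : ℤ_[ℓ], (X : ℚ_[ℓ]) = x := ⟨⟨_, hX⟩, rfl⟩
  obtain ⟨Y, hYc⟩ : ∃ Y : ℤ_[ℓ], (Y : ℚ_[ℓ]) = y := ⟨⟨_, hY⟩, rfl⟩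
  obtain ⟨α₁, h₁⟩ : ∃ α : ℤ_[ℓ], (α : ℚ_[ℓ]) = W.a₁ := ⟨⟨_, ha₁⟩, rfl⟩
  obtain ⟨α₂, h₂⟩ : ∃ α : ℤ_[ℓ], (α : ℚ_[ℓ]) = W.a₂ := ⟨⟨_, ha₂⟩, rfl⟩
  obtain ⟨α₃, h₃⟩ : ∃ α : ℤ_[ℓ], (α : ℚ_[ℓ]) = W.a₃ := ⟨⟨_, ha₃⟩, rfl⟩
  obtain ⟨α₄, h₄⟩ : ∃ α : ℤ_[ℓ], (α : ℚ_[ℓ]) = W.a₄ := ⟨⟨_, ha₄⟩, rfl⟩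
  obtain ⟨α₆, h₆⟩ : ∃ α : ℤ_[ℓ], (α : ℚ_[ℓ]) = W.a₆ := ⟨⟨_, ha₆⟩, rfl⟩
  set V : WeierstrassCurve ℤ_[ℓ] := ⟨α₁, α₂, α₃, α₄, α₆⟩ with hV
  -- the curve equation in `ℤ_ℓ`
  have hE : y ^ 2 + W.a₁ * x * y + W.a₃ * y = x ^ 3 + W.a₂ * x ^ 2 + W.a₄ * x + W.a₆ :=
    (WeierstrassCurve.Affine.equation_iff x y).mp h.1
  have hEQ := congrArg (fun q : ℚ ↦ (q : ℚ_[ℓ])) hE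
  push_cast at hEQ
  have heq : Y ^ 2 + V.a₁ * X * Y + V.a₃ * Y - (X ^ 3 + V.a₂ * X ^ 2 + V.a₄ * X + V.a₆) = 0 := by
    apply Subtype.ext
    push_cast
    rw [hXc, hYc, h₁, h₂, h₃, h₄, h₆]
    linear_combination hEQ
  -- the translated coefficients `A₃ = Φ_y(P)`, `A₄ = -Φ_x(P)` have norm `≤ ℓ⁻¹`
  set A₂ : ℤ_[ℓ] := V.a₂ + 3 * X with hA₂
  set A₃ : ℤ_[ℓ] := 2 * Y + V.a₁ * X + V.a₃ with hA₃
  set A₄ : ℤ_[ℓ] := 3 * X ^ 2 + 2 * V.a₂ * X + V.a₄ - V.a₁ * Y with hA₄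
  set B₂ : ℤ_[ℓ] := V.a₁ ^ 2 + 4 * A₂ with hB₂
  -- numerals of `ℤ_ℓ` coerce to the numerals of `ℚ_ℓ` (there is no `PadicInt.coe_ofNat` simp lemma)
  have c2 : ((2 : ℤ_[ℓ]) : ℚ_[ℓ]) = 2 := rfl
  have c3 : ((3 : ℤ_[ℓ]) : ℚ_[ℓ]) = 3 := rfl
  have c4 : ((4 : ℤ_[ℓ]) : ℚ_[ℓ]) = 4 := rfl
  have c8 : ((8 : ℤ_[ℓ]) : ℚ_[ℓ]) = 8 := rfl
  have c9 : ((9 : ℤ_[ℓ]) : ℚ_[ℓ]) = 9 := rfl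
  have c27 : ((27 : ℤ_[ℓ]) : ℚ_[ℓ]) = 27 := rfl
  have hA₃c : (A₃ : ℚ_[ℓ]) = ((W.toAffine.polynomialY.evalEval x y : ℚ) : ℚ_[ℓ]) := by
    rw [WeierstrassCurve.Affine.evalEval_polynomialY, hA₃]
    push_cast
    rw [hXc, hYc, h₁, h₃, c2]
  have hA₄c : (A₄ : ℚ_[ℓ]) = -((W.toAffine.polynomialX.evalEval x y : ℚ) : ℚ_[ℓ]) := by
    rw [WeierstrassCurve.Affine.evalEval_polynomialX, hA₄]
    push_cast
    rw [hXc, hYc, h₁, h₂, h₄, c2, c3]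
    ring
  have hlt_of_ne : ∀ (q : ℚ) (Z : ℤ_[ℓ]), ‖(Z : ℚ_[ℓ])‖ = ‖((q : ℚ) : ℚ_[ℓ])‖ →
      (q ≠ 0 → padicValRat ℓ q ≠ 0) → ‖Z‖ ≤ (ℓ : ℝ)⁻¹ := by
    intro q Z hZq hq
    have hne : ‖((q : ℚ) : ℚ_[ℓ])‖ ≠ 1 := fun h1 ↦ by
      obtain ⟨hq0, hv0⟩ := (norm_ratCast_eq_one_iff ℓ q).mp h1
      exact hq hq0 hv0
    have hle : ‖((q : ℚ) : ℚ_[ℓ])‖ ≤ 1 := by rw [← hZq, PadicInt.padic_norm_e_of_padicInt]; exact Z.2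
    have hlt : ‖((q : ℚ) : ℚ_[ℓ])‖ < 1 := lt_of_le_of_ne hle hne
    rw [← PadicInt.padic_norm_e_of_padicInt, hZq]
    exact norm_le_inv_of_norm_lt_one hlt
  have hA₃n : ‖A₃‖ ≤ (ℓ : ℝ)⁻¹ := hlt_of_ne _ A₃ (by rw [hA₃c]) hΦy
  have hA₄n : ‖A₄‖ ≤ (ℓ : ℝ)⁻¹ := hlt_of_ne _ A₄ (by rw [hA₄c, norm_neg]) hΦx
  -- the identity and the norm estimate in `ℤ_ℓ`
  have hΔV := Δ_eq_of_point V X Y heq hA₂ hA₃ hA₄ hB₂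
  have hcast : (W.Δ : ℚ_[ℓ]) = ((V.Δ : ℤ_[ℓ]) : ℚ_[ℓ]) := by
    simp only [hV, WeierstrassCurve.Δ, WeierstrassCurve.b₂, WeierstrassCurve.b₄, WeierstrassCurve.b₆,
      WeierstrassCurve.b₈]
    push_cast
    rw [h₁, h₂, h₃, h₄, h₆, c2, c4, c8, c9, c27]
  have hℓ0 : (0 : ℝ) ≤ (ℓ : ℝ)⁻¹ := by positivity
  -- `‖Z T U‖ ≤ ℓ⁻²` whenever `‖Z‖, ‖T‖ ≤ ℓ⁻¹` (`‖U‖ ≤ 1` automatically in `ℤ_ℓ`)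
  have hsq : ∀ Z T U : ℤ_[ℓ], ‖Z‖ ≤ (ℓ : ℝ)⁻¹ → ‖T‖ ≤ (ℓ : ℝ)⁻¹ →
      ‖Z * T * U‖ ≤ (ℓ : ℝ)⁻¹ ^ 2 := by
    intro Z T U hZ hT
    rw [norm_mul, norm_mul, sq, ← mul_one ((ℓ : ℝ)⁻¹ * (ℓ : ℝ)⁻¹)]
    exact mul_le_mul (mul_le_mul hZ hT (norm_nonneg _) hℓ0) (PadicInt.norm_le_one U) (norm_nonneg _)
      (mul_nonneg hℓ0 hℓ0)
  have key : ‖V.Δ‖ ≤ (ℓ : ℝ)⁻¹ ^ 2 := by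
    rw [hΔV, sq A₃, sq A₄]
    exact (PadicInt.nonarchimedean _ _).trans (max_le ((PadicInt.nonarchimedean _ _).trans
      (max_le (hsq _ _ _ hA₃n hA₃n) (hsq _ _ _ hA₃n hA₄n))) (hsq _ _ _ hA₄n hA₄n))
  rw [hcast, PadicInt.padic_norm_e_of_padicInt]
  exact key

/-- **`v_ℓ(Δ_W) ≤ 1 ⇒ E(ℚ) ∩ E⁰(ℚ_ℓ) = E(ℚ)`** in the norm form `ℓ⁻² < ‖Δ_W‖_ℓ` (`ℤ`-integral
equation): the only reduction types with `ℓ² ∤ Δ` are I₀ (good) and I₁ (a node with trivial component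
group), and in both every rational point has non-singular reduction. [cite: SilvermanAEC2009, VII.2.1 and VII.6.1] -/
theorem nonsingularReductionSubgroupAt_eq_top_of_lt_norm_Δ (hΔ : (ℓ : ℝ)⁻¹ ^ 2 < ‖(W.Δ : ℚ_[ℓ])‖) :
    W.nonsingularReductionSubgroupAt ℓ = ⊤ := by
  rw [eq_top_iff]
  rintro P -
  rcases P with _ | ⟨x, y, h⟩
  · exact AddSubgroup.zero_mem _
  · refine (mem_nonsingularReductionSubgroupAt_iff _).mpr ((W.reducesNonsingularlyAt_some ℓ h).mpr ?_)
    by_contra hns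
    exact (not_le.mpr hΔ) (W.norm_Δ_le_of_not_hasNonsingularReductionAt ℓ h hns)

end SingularPoint

section SingularPointMinimal

variable (W : WeierstrassCurve ℚ) [W.IsGloballyMinimal] (ℓ : ℕ) [Fact ℓ.Prime]

/-- **For a globally minimal equation with `ℓ² ∤ Δ_min` (reduction I₀ or I₁ at `ℓ`),
`[E(ℚ) : E(ℚ) ∩ E⁰(ℚ_ℓ)] = 1`.** So in a family sieved to square-free discriminant away from a finite set
`S` of primes, the index hypothesis of `norm_pairing_le_of_not_anomalous` holds automatically at every
`ℓ ∉ S` (`c_ℓ = 1` there). [cite: SilvermanAEC2009, VII.2.1 and VII.6.1] -/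
theorem index_nonsingularReductionSubgroupAt_eq_one_of_not_sq_dvd
    (hΔ : ¬ ((ℓ : ℤ) ^ 2 ∣ minimalDiscriminantInt W)) : (W.nonsingularReductionSubgroupAt ℓ).index = 1 := by
  rw [W.nonsingularReductionSubgroupAt_eq_top_of_lt_norm_Δ ℓ ?_, AddSubgroup.index_top]
  have hcast : (W.Δ : ℚ_[ℓ]) = ((minimalDiscriminantInt W : ℤ) : ℚ_[ℓ]) := by
    rw [← cast_minimalDiscriminantInt W, Rat.cast_intCast]
  rw [hcast]
  have h := (Padic.norm_int_le_pow_iff_dvd (minimalDiscriminantInt W) 2).not.mpr (by exact_mod_cast hΔ)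
  rw [not_le] at h
  have e : (ℓ : ℝ)⁻¹ ^ 2 = (ℓ : ℝ) ^ (-(2 : ℕ) : ℤ) := by rw [zpow_neg, zpow_natCast, inv_pow]
  rw [e]; exact h

end SingularPointMinimal

end WeierstrassCurve

end
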